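import Summits.ResolutionOfSingularities.ResolutionOfSingularities.Theses.HomologicalConductor
import Summits.ResolutionOfSingularities.ResolutionOfSingularities.Theorems.NoZeno.Negative.SurfaceKernelDescentModuloLU
import Summits.ResolutionOfSingularities.ResolutionOfSingularities.Theorems.HomologicalConductorNoZenoSurfaceLU

/-!
# Crux `NoZeno` (stmt-ResolutionOfSingularities-16483) — triage of the descent cards: no residual
# valuation input modulo resolution of excellent surfaces (F-04)

Route `ResolutionOfSingularities/HomologicalConductor`, crux
`Summit.ResolutionOfSingularities.ResolutionOfSingularities.Theses.HomologicalConductor.NoZeno`,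
line `birth` (skeleton v9). Negative lane (`--supports` the crux item); OURS (res-L0-w44-tri-1,
BARRIER & DEFECT triage). Composition of `surfaceKernel_false_of_descent_of_isLocallyUniformizable`
(p470040) with res-L0-w44-stub-1's `stub_surfaceLU_of_cossartJannsenSaito2020` (p468911, valuative
criterion bridge `ResolutionLU`): under the named fact `CossartJannsenSaito2020` (FACT-LIST F-04) a
sandwiched-descent function `ρ` (crux-ideas `sandwich-subgraph-descent`, `minres-base-point-free-ca`)
refutes every surface kernel datum over EVERY ground field — the defect habitat and imperfect `k`
carry no extra input. Kernel-only axioms; no `def`, the named fact enters as a hypothesis.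
-/

set_option linter.dupNamespace false

noncomputable section

namespace Summit.ResolutionOfSingularities.ResolutionOfSingularities.Theorems.NoZeno.Negative

open Summit.ResolutionOfSingularities.ResolutionOfSingularities.Theorems
open Summit.ResolutionOfSingularities.ResolutionOfSingularities.Theorems.NoZeno.Birth
open Literature.AlgebraicGeometry.Resolution

variable {k K : Type} [Field k] [Field K] [Algebra k K]

/-- **A sandwiched-descent function kills the surface kernel over EVERY ground field, modulo only the
published resolution of excellent surfaces** (`CossartJannsenSaito2020`, FACT-LIST F-04, through
res-L0-w44-stub-1's `stub_surfaceLU_of_cossartJannsenSaito2020`, p468911). Triage verdict for the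
crux-ideas `sandwich-subgraph-descent` (idea-2) and `minres-base-point-free-ca` (idea-1): their
descent lever has NO residual valuation-theoretic input — defect habitat and imperfect `k` included.
[folklore] -/
theorem surfaceKernel_false_of_descent (hCJS : CossartJannsenSaito2020.{0}) (O : ValuationSubring K)
    (A : Subalgebra k K) (hk : ∀ c : k, algebraMap k K c ∈ O) (hA : A.FG)
    (hfr : IsFractionRing ↥A K) (hAO : A.toSubring ≤ O.toSubring)
    (hker : ∀ O' : ValuationSubring K,
      (∀ m : ℕ, ∀ s ∈ tower O A m, s ∈ O' ∧ (s⁻¹ ∈ O' → s⁻¹ ∈ O)) → ¬ IsNoetherianRing ↥O')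
    (htr : Algebra.trdeg k K = 2) (ρ : Subalgebra k K → ℕ)
    (hρ : ∀ m : ℕ, (∃ R : Subalgebra k K, R.FG ∧ R.toSubring ≤ O.toSubring ∧
        IsFractionRing ↥R K ∧ loc O R ≤ tower O A m ∧ IsRegularLocalRing ↥(loc O R)) →
      ¬ IsRegularLocalRing ↥(tower O A m) → ρ (tower O A (m + 1)) < ρ (tower O A m)) : False := by
  haveI := hfr
  haveI : Algebra.FiniteType k ↥A := A.fg_iff_finiteType.mp hA
  have hfg : (⊤ : IntermediateField k K).FG :=
    IntermediateField.fg_top_of_isFractionRing_of_finiteType k ↥A K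
  exact surfaceKernel_false_of_descent_of_isLocallyUniformizable O A hk hA hfr hAO hker htr ρ hρ
    (stub_surfaceLU_of_cossartJannsenSaito2020 hCJS k K hfg htr.le O hk)

/-- The same in the shape of the v9 registry: under `CossartJannsenSaito2020`, a sandwiched-descent
function turns the kernel conclusion `∃ m, IsRegularLocalRing (tower O A m)` of
`stub_sandwichedTermination` into a theorem (vacuously: the kernel datum is contradictory).
[folklore] -/
theorem surfaceKernel_conclusion_of_descent (hCJS : CossartJannsenSaito2020.{0})
    (O : ValuationSubring K) (A : Subalgebra k K) (hk : ∀ c : k, algebraMap k K c ∈ O) (hA : A.FG)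
    (hfr : IsFractionRing ↥A K) (hAO : A.toSubring ≤ O.toSubring)
    (hker : ∀ O' : ValuationSubring K,
      (∀ m : ℕ, ∀ s ∈ tower O A m, s ∈ O' ∧ (s⁻¹ ∈ O' → s⁻¹ ∈ O)) → ¬ IsNoetherianRing ↥O')
    (htr : Algebra.trdeg k K = 2) (ρ : Subalgebra k K → ℕ)
    (hρ : ∀ m : ℕ, (∃ R : Subalgebra k K, R.FG ∧ R.toSubring ≤ O.toSubring ∧
        IsFractionRing ↥R K ∧ loc O R ≤ tower O A m ∧ IsRegularLocalRing ↥(loc O R)) →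
      ¬ IsRegularLocalRing ↥(tower O A m) → ρ (tower O A (m + 1)) < ρ (tower O A m)) :
    ∃ m : ℕ, IsRegularLocalRing ↥(tower O A m) :=
  (surfaceKernel_false_of_descent hCJS O A hk hA hfr hAO hker htr ρ hρ).elim

end Summit.ResolutionOfSingularities.ResolutionOfSingularities.Theorems.NoZeno.Negative

end
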